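import Literature.AlgebraicGeometry.Morphisms.FormalModuleSerreA
import Literature.AlgebraicGeometry.Morphisms.FormalModuleAlgebraize
import Literature.AlgebraicGeometry.Morphisms.FormalModuleHomFree
import Literature.AlgebraicGeometry.Morphisms.FormalModuleProjective
import Literature.AlgebraicGeometry.Morphisms.CechModuleAffine
import Literature.AlgebraicGeometry.Morphisms.CohAffineExactness
import Literature.AlgebraicGeometry.Modules.CohFinitePresentation
import Literature.AlgebraicGeometry.Modules.IsZeroOfAffineCover
import HarnessLib

/-!
# Grothendieck's existence theorem on an affine scheme

Görtz–Wedhorn, *Algebraic Geometry II* (2023), Prop. 24.88 (1) / Thm. 24.94 for `X = Spec B`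
affine over an `I`-adically complete noetherian `A` (EGA III₁ 5.1.4 with 1.4; Stacks 087X for the
affine comparison `Coh(Spec B, I) ≃` finite `B^∧`-modules): **every formal coherent module on an
AFFINE scheme proper over a complete noetherian ring is algebraizable** — in the tower language of
`Morphisms/FormalModuleTower`, a formal tower `F` of coherent modules along `a` on an affine `X`
proper over `Spec A` (`A` noetherian, `a`-adically complete) is isomorphic to the completion tower
`(G/aⁿ⁺¹G)_n` of a coherent `G`.

The proof is that of the projective case (`Morphisms/FormalModuleProjective`, GW II Lemma 24.103)
with the twisting sheaves replaced by free modules: on an affine scheme a coherent module is a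
quotient of `𝒪_X^r` (`exists_epi_free_of_coh`) and `Ȟ¹` of an affine-localizing module for the
one-member cover `{X}` vanishes (`Morphisms/CechModuleAffine`), so the lifting lemma
`exists_comp_eq_of_epi_of_subsingleton_cechMH1` produces compatible lifts, whence a levelwise
epimorphism `(𝒪^r/aⁿ⁺¹) → F` (`exists_levelwise_epi_cmplTower_free`); then the kernel tower,
a second presentation, `existsUnique_cmplMap_free` (GW II Cor. 24.100 for free sources) and
`Morphisms/FormalModuleAlgebraize`.

* `exists_epi_free_of_coh` — a coherent module on an affine scheme is a quotient of `𝒪^r`;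
* `exists_towerHom_of_compatible'` — compatible `vₙ : L → Fₙ` give `(L/aⁿ⁺¹L)_n → F`;
* `exists_levelwise_epi_cmplTower_free` — affine Serre A for coherent formal towers;
* **`exists_coh_iso_cmplTower_of_isAffine`** — the theorem.

Everything is proved; no named facts.

## References

* U. Görtz, T. Wedhorn, *Algebraic Geometry II: Cohomology of Schemes*, Springer Spektrum (2023),
  Prop. 24.88, Thm. 24.94, Lemma 24.103 (pp. 563–570). [GortzWedhorn2023]
* A. Grothendieck, EGA III₁ (1961), 5.1.4, 5.2. [EGAIII1]
* The Stacks Project, Tags 087X, 0885, 088C. [StacksProject]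
-/

noncomputable section

-- `TopCat.Presheaf`/`Scheme.Modules` are not reducible (as in Mathlib's `AlgebraicGeometry/Modules`).
set_option backward.isDefEq.respectTransparency false

open CategoryTheory AlgebraicGeometry Limits TopologicalSpace Opposite
open Literature.AlgebraicGeometry.Modules Literature.AlgebraicGeometry.Motives
open Literature.AlgebraicGeometry.KTheory

universe u

namespace Literature.AlgebraicGeometry.Morphisms

/-! ### A coherent module on an affine scheme is a quotient of a free module of finite rank -/

section EpiFree

variable {X : Scheme.{u}}

/-- The free `𝒪_X`-module of rank `r` (Mathlib's `SheafOfModules.free` on `ULift (Fin r)`), as an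
object of `X.Modules`. [folklore] -/
def freeMod (X : Scheme.{u}) (r : ℕ) : X.Modules := SheafOfModules.free (ULift.{u} (Fin r))

/-- The morphism `𝒪_X^r → M` given by `r` global sections. [folklore] -/
def freeHomOfSections (M : X.Modules) {r : ℕ} (s : Fin r → Γ(M, ⊤)) : freeMod X r ⟶ M :=
  show (SheafOfModules.free (ULift.{u} (Fin r)) : X.Modules) ⟶ M from
    M.freeHomEquiv.symm fun i => (sectionsEquivTop M).symm (s i.down)

/-- Its value on the `i`-th basis section is `sᵢ`. [folklore] -/
theorem freeHomOfSections_app_top (M : X.Modules) {r : ℕ} (s : Fin r → Γ(M, ⊤)) (i : Fin r) :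
    (freeHomOfSections M s).app ⊤
      (sectionsEquivTop (freeMod X r) (SheafOfModules.freeSection (ULift.up i))) = s i := by
  have h := sectionsEquivTop_sectionsMap (freeHomOfSections M s)
    (SheafOfModules.freeSection (ULift.up i))
  refine h.symm.trans ?_
  change sectionsEquivTop M (SheafOfModules.sectionsMap
    (M.freeHomEquiv.symm fun i => (sectionsEquivTop M).symm (s i.down))
    (SheafOfModules.freeSection (ULift.up i))) = s i
  rw [SheafOfModules.sectionsMap_freeHomEquiv_symm_freeSection, Equiv.apply_symm_apply]

/-- `freeMod X r` is coherent on a locally noetherian `X`. [folklore] -/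
theorem coh_freeMod [IsLocallyNoetherian X] (r : ℕ) : Coh (freeMod X r) := coh_free _

/-- `freeMod X r` is finite locally free. [folklore] -/
theorem isFiniteLocallyFree_freeMod (r : ℕ) : IsFiniteLocallyFree (freeMod X r) :=
  KZero.isFiniteLocallyFree_free _

/-- **A coherent module on an affine scheme is a quotient of `𝒪_X^r`**: generators of the finite
`Γ(X, 𝒪_X)`-module `Γ(X, M)` give an epimorphism (its cokernel is affine-localizing with no global
sections). [cite: GortzWedhorn2020, Cor 7.48] -/
theorem exists_epi_free_of_coh [IsAffine X] [IsLocallyNoetherian X] {M : X.Modules} (hM : Coh M) :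
    ∃ (r : ℕ) (p : freeMod X r ⟶ M), Epi p := by
  have hXaff : IsAffineOpen (⊤ : X.Opens) := isAffineOpen_top X
  haveI : Module.Finite Γ(X, ⊤) Γ(M, ⊤) := hM.ft hXaff
  obtain ⟨r, s, hs⟩ := Module.Finite.exists_fin (R := Γ(X, ⊤)) (M := Γ(M, ⊤))
  refine ⟨r, freeHomOfSections M s, ?_⟩
  set p := freeHomOfSections M s with hp
  have hLc : Coh (freeMod X r) := coh_freeMod r
  have hC : Coh (cokernel p) := Coh.cokernel p hLc hM
  -- every global section of `M` is in the image of `p`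
  have himage : ∀ y : Γ(M, ⊤), ∃ x, p.app ⊤ x = y := by
    intro y
    have hy : y ∈ Submodule.span Γ(X, ⊤) (Set.range s) := by rw [hs]; trivial
    refine Submodule.span_induction (p := fun y _ => ∃ x, p.app ⊤ x = y) ?_ ⟨0, map_zero _⟩
      ?_ ?_ hy
    · rintro _ ⟨i, rfl⟩
      exact ⟨_, freeHomOfSections_app_top M s i⟩
    · rintro _ _ _ _ ⟨x, rfl⟩ ⟨x', rfl⟩
      exact ⟨x + x', map_add _ _ _⟩
    · rintro c _ _ ⟨x, rfl⟩
      exact ⟨c • x, Scheme.Modules.Hom.app_smul _ _ _⟩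
  -- hence the cokernel has no global sections, hence is zero
  have h0 : ∀ z : Γ(cokernel p, ⊤), z = 0 := by
    intro z
    obtain ⟨y, rfl⟩ := app_surjective_of_epi (cokernel.π p) hM.loc hC.loc hXaff z
    obtain ⟨x, rfl⟩ := himage y
    change ((p ≫ cokernel.π p).app ⊤) x = 0
    rw [cokernel.condition]
    rfl
  have hZ : IsZero (cokernel p) :=
    hC.loc.isZero_of_cover (fun _ : Unit => ⊤) (fun _ => hXaff) (iSup_const) fun _ z => h0 z
  exact Preadditive.epi_of_isZero_cokernel' _ (cokernelIsCokernel p) hZ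

end EpiFree

/-! ### Affine Serre A for coherent formal towers -/

section SerreA

variable {X : Scheme.{u}} (a : Γ(X, ⊤)) {F : ℕᵒᵖ ⥤ X.Modules} (hF : IsFormalTower a F)

include hF in
/-- A compatible family `vₙ : L → Fₙ` induces a morphism of towers `(L/aⁿ⁺¹L)_n → F` which is `vₙ` on
`L → L/aⁿ⁺¹L` (as `Morphisms/FormalModuleSerreA.exists_towerHom_of_compatible`, for any scheme).
[cite: GortzWedhorn2023, (24.18.1) and Lemma 24.103, proof (p. 570)] -/
theorem exists_towerHom_of_compatible' {L : X.Modules} (v : ∀ n, L ⟶ F.obj ⟨n⟩)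
    (hv : ∀ n, v (n + 1) ≫ towerπ F n = v n) :
    ∃ q : cmplTower a L ⟶ F, ∀ n, cmplπ a L n ≫ q.app ⟨n⟩ = v n := by
  have hkill : ∀ n, globalScalar L (a ^ (n + 1)) ≫ v n = 0 := fun n => by
    rw [globalScalar_comp, hF.killed n, Limits.comp_zero]
  refine ⟨NatTrans.ofOpSequence (fun n => cokernel.desc _ (v n) (hkill n)) fun n => ?_, fun n => ?_⟩
  · change towerπ (cmplTower a L) n ≫ cokernel.desc _ (v n) (hkill n) =
      cokernel.desc _ (v (n + 1)) (hkill (n + 1)) ≫ towerπ F n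
    rw [towerπ_cmplTower, ← cancel_epi (cmplπ a L (n + 1)), ← Category.assoc, cmplπ_cmplStep,
      cokernel.π_desc, ← Category.assoc, cokernel.π_desc, hv]
  · exact cokernel.π_desc _ _ _

variable [IsAffine X] [IsLocallyNoetherian X] (hFc : ∀ n, Coh (F.obj ⟨n⟩))

include hF hFc in
/-- **Compatible lifts on an affine scheme**: every `v₀ : 𝒪^r → F₀` extends to a compatible family
`vₙ : 𝒪^r → Fₙ` (the obstruction `Ȟ¹({X}; 𝓗om(𝒪^r, grₙF))` vanishes on the affine `X`).
[cite: GortzWedhorn2023, Lemma 24.103, proof, Step 1 (p. 570)] -/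
theorem exists_compatible_lifts_free {r : ℕ} (v₀ : freeMod X r ⟶ F.obj ⟨0⟩) :
    ∃ v : ∀ n, freeMod X r ⟶ F.obj ⟨n⟩, v 0 = v₀ ∧ ∀ n, v (n + 1) ≫ towerπ F n = v n := by
  have hXaff : IsAffineOpen (⊤ : X.Opens) := isAffineOpen_top X
  have hL : IsFiniteLocallyFree (freeMod X r) := isFiniteLocallyFree_freeMod r
  have hLc : Coh (freeMod X r) := coh_freeMod r
  have hstep : ∀ (n : ℕ) (vn : freeMod X r ⟶ F.obj ⟨n⟩),
      ∃ w : freeMod X r ⟶ F.obj ⟨n + 1⟩, w ≫ towerπ F n = vn := by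
    intro n vn
    haveI := hF.epi n
    have hQ : IsAffineLocalizing (sheafHom (freeMod X r) (kernel (towerπ F n))) :=
      isAffineLocalizing_sheafHom hLc.loc hLc.ft (hF.coh_gr hFc n).loc
    haveI : Subsingleton (CechMH1 X.isoSpec.hom (sheafHom (freeMod X r) (kernel (towerπ F n)))
        (fun _ : PUnit.{u + 1} => (⊤ : X.Opens))) :=
      ⟨fun x y => by
        rw [cechMH1_eq_zero_of_isAffineOpen X.isoSpec.hom hQ hXaff (fun _ : PUnit.{u + 1} => ⊤)
          iSup_const x, cechMH1_eq_zero_of_isAffineOpen X.isoSpec.hom hQ hXaff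
          (fun _ : PUnit.{u + 1} => ⊤) iSup_const y]⟩
    exact exists_comp_eq_of_epi_of_subsingleton_cechMH1 X.isoSpec.hom (fun _ : PUnit.{u + 1} => ⊤)
      (fun _ => hXaff) iSup_const hL (towerπ F n) hQ inferInstance vn
  choose w hw using hstep
  let v : ∀ n, freeMod X r ⟶ F.obj ⟨n⟩ := fun n => Nat.rec v₀ (fun k vk => w k vk) n
  exact ⟨v, rfl, fun n => hw n (v n)⟩

include hF hFc in
/-- **Affine Serre A for coherent formal towers**: on an affine locally noetherian scheme every
coherent formal tower `F` along `a` receives a morphism of towers `(𝒪^r/aⁿ⁺¹)_n → F` which is an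
epimorphism at every level. [cite: GortzWedhorn2023, Lemma 24.103, proof, Step 1 (p. 570)] -/
theorem exists_levelwise_epi_cmplTower_free :
    ∃ (r : ℕ) (q : cmplTower a (freeMod X r) ⟶ F), ∀ n, Epi (q.app ⟨n⟩) := by
  obtain ⟨r, p₀, hp₀⟩ := exists_epi_free_of_coh (hFc 0)
  obtain ⟨v, hv0, hv⟩ := exists_compatible_lifts_free a hF hFc p₀
  obtain ⟨q, hq⟩ := exists_towerHom_of_compatible' a hF v hv
  refine ⟨r, q, fun n => ?_⟩
  haveI : Epi (q.app ⟨0⟩) := by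
    haveI : Epi (cmplπ a (freeMod X r) 0 ≫ q.app ⟨0⟩) := by
      rw [hq 0, hv0]; exact hp₀
    exact epi_of_epi (cmplπ a (freeMod X r) 0) _
  exact IsFormalTower.epi_app_of_epi_app_zero
    (fun k => (isFormalTower_cmplTower a (freeMod X r)).epi k) hF q n

end SerreA

/-! ### Grothendieck's existence theorem on an affine scheme -/

section Affine

variable {A : Type u} [CommRing A] [IsNoetherianRing A] (a : A) [IsAdicComplete (Ideal.span {a}) A]
  {X : Scheme.{u}} (f : X ⟶ Spec (.of A)) [IsProper f] [IsAffine X]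
  {F : ℕᵒᵖ ⥤ X.Modules} (hF : IsFormalTower (algebraMapΓ f a) F) (hFc : ∀ n, Coh (F.obj ⟨n⟩))

include hF hFc in
/-- **Grothendieck's existence theorem, affine case** (GW II Thm. 24.94 / Prop. 24.88 for `X` affine;
EGA III₁ 5.1.4; Stacks 087X): for `A` Noetherian and `a`-adically complete and `X` AFFINE and
proper over `Spec A`, every formal tower `F` of coherent `𝒪_X`-modules along `a` is isomorphic, as
a tower, to the completion tower `(G/aⁿ⁺¹G)_n` of a coherent `𝒪_X`-module `G`.
[cite: GortzWedhorn2023, Thm. 24.94 and Lemma 24.103 (pp. 566–570)] [cite: StacksProject, Tag 087X] -/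
theorem exists_coh_iso_cmplTower_of_isAffine :
    ∃ G : X.Modules, Coh G ∧ Nonempty (F ≅ cmplTower (algebraMapΓ f a) G) := by
  haveI : IsLocallyNoetherian X := LocallyOfFiniteType.isLocallyNoetherian f
  set a' : Γ(X, ⊤) := algebraMapΓ f a with ha'
  -- Step 1: a levelwise epimorphism `q : (L/aⁿ⁺¹L) → F` from a free `L`
  obtain ⟨r, q, hq⟩ := exists_levelwise_epi_cmplTower_free a' hF hFc
  have hLc : Coh (freeMod X r) := coh_freeMod r
  have hP : IsFormalTower a' (cmplTower a' (freeMod X r)) := isFormalTower_cmplTower a' _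
  have hPc : ∀ n, Coh ((cmplTower a' (freeMod X r)).obj ⟨n⟩) := coh_cmplTower a' hLc
  -- its kernel, a coherent formal tower after an Artin–Rees shift `c`
  obtain ⟨c, hK⟩ := exists_isFormalTower_kerShift (u := q) hP hF hPc hFc hq
  have hKc : ∀ n, Coh ((kerShift a' q c).obj ⟨n⟩) := fun n =>
    coh_kerShift (a := a') (u := q) (c := c) hPc hFc n
  -- Step 1 again for the kernel
  obtain ⟨r', q', hq'⟩ := exists_levelwise_epi_cmplTower_free a' hK hKc
  have hL'c : Coh (freeMod X r') := coh_freeMod r'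
  -- the presentation `(L'/aⁿ⁺¹) → (L/aⁿ⁺¹) → F → 0` and its algebraization `v : L' → L`
  obtain ⟨v, hv, -⟩ := existsUnique_cmplMap_free f a (I := ULift.{u} (Fin r')) hLc
    (q' ≫ kerShiftAugHom q c hP)
  refine ⟨cokernel v, Coh.cokernel _ hL'c hLc, ?_⟩
  have hex := exact_cmplMapApp_of_presentation a' v q c q' hF hPc hFc hq hq' hv.symm
  have key : ∀ n : ℕ, ∃ e : F.obj ⟨n⟩ ≅ cmplObj a' (cokernel v) n,
      q.app ⟨n⟩ ≫ e.hom = cmplMapApp a' (cokernel.π v) n := by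
    intro n
    haveI : Epi (ShortComplex.mk (cmplMapApp a' v n) (q.app ⟨n⟩)
        (cmplMapApp_comp_app_of_presentation a' v q c q' hv.symm n)).g := hq n
    refine ⟨(hex n).gIsCokernel.coconePointUniqueUpToIso (cokernelIsCokernel (cmplMapApp a' v n)) ≪≫
      cokernelCmplMapAppIso a' v n, ?_⟩
    have k1 : q.app ⟨n⟩ ≫ ((hex n).gIsCokernel.coconePointUniqueUpToIso
        (cokernelIsCokernel (cmplMapApp a' v n))).hom = cokernel.π (cmplMapApp a' v n) :=
      (hex n).gIsCokernel.comp_coconePointUniqueUpToIso_hom (cokernelIsCokernel (cmplMapApp a' v n))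
        WalkingParallelPair.one
    rw [Iso.trans_hom, ← Category.assoc, k1]
    exact cokernel_π_cokernelCmplMapAppIso_hom a' v n
  choose e he using key
  obtain ⟨E, -⟩ := exists_natIso_of_levelwise q (cmplMap a' (cokernel.π v)) (fun n => hq n.unop)
    (fun n => e n.unop) fun n => he n.unop
  exact ⟨E⟩

end Affine

end Literature.AlgebraicGeometry.Morphisms

end
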